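import Summits.ResolutionOfSingularities.ResolutionOfSingularities.Theorems.RadicialJungCleanModelsF75cPrincipalizationGeneral
import Summits.ResolutionOfSingularities.ResolutionOfSingularities.Theorems.RadicialJungCleanModelsF75cMainIntegral
import Literature.AlgebraicGeometry.Resolution.StrictTransformGenericPoint
import HarnessLib

/-!
# [F-75c DISCHARGED] The Stacks Project, Lemma 54.15.6 = Tag 0BIC with the locus of the centres:
# `Stacks0BIC_embeddedResolutionCurvesInSurfaces_locus` HOLDS

Cell res-hironaka, D-0154 INPUTS discharger `res-inputs-p-f75c` (KEEP lineage) for the named fact F-75c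
`Literature.AlgebraicGeometry.Resolution.Stacks0BIC_embeddedResolutionCurvesInSurfaces_locus`
(`EmbeddedResolutionCurvesInSurfaces.lean`; consumers `stub_stacks0BICLocus` of `Cruxes/DescentPerfectToAll/Lines/via_clean_models.lean`
and `cleanModels_dimTwo_of_f75c`; `--supports stmt-ResolutionOfSingularities-15917 --as helper`).

* `IsPointBlowupComposition.isNowhereDense_preimage` — the inverse image of a nowhere dense closed set containing the
  centres under a composition of point blow-ups is nowhere dense (exceptional divisors are Cartier);
* `stacks0BIC_locus` — F-75c's conclusion for `X` Noetherian with regular local rings, excellent, `dim X ≤ 2` (NOT assumed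
  integral): Cartier step by brick N3 (principalization component by component) + `isEffectiveCartier_of_isLocallyPrincipal_
  of_isNowhereDense` (N1), then the integrality-free snc pipeline A1 → L1 → L2 → L3 of the integral assembly;
* **`stacks0BIC_embeddedResolutionCurvesInSurfaces_locus_holds : Stacks0BIC_embeddedResolutionCurvesInSurfaces_locus`** —
  THE DISCHARGE (universe-polymorphic; users' hypotheses `(h75c : …_locus)` are fed this theorem).

HONEST FRAMING: kernel bookkeeping of a printed theorem (Stacks 0BIC/0BIB/0AHH/0BI7/0BIA, proved here E-first: Cartier step via
Zariski's finiteness of base points instead of the cohomological Lemma 54.3.5); it removes the typing debt F-75c under the dim-2 slice of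
rung B and the W4.2 surface phase; it is NOT progress on resolution in positive characteristic and nothing here is a statement of
[Hironaka2017]. AI-written; AI review is weaker than expert review.
References: The Stacks Project, Tags 0BIC, 0BIB, 0AHH, 0BI7, 0BIA [StacksProject].
-/

noncomputable section

set_option linter.dupNamespace false -- mandated namespace of this single-conjunct summit

open CategoryTheory AlgebraicGeometry TopologicalSpace IsLocalRing

universe u

namespace Summit.ResolutionOfSingularities.ResolutionOfSingularities.Theorems

namespace F75c

open Literature.AlgebraicGeometry.Resolution
open Scheme.IdealSheafData

/-! ## Inverse images of nowhere dense sets -/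

/-- **Under a composition of point blow-ups with centres over a nowhere dense closed set `S`, the inverse image of `S`
is nowhere dense**: off the exceptional divisor a blowing up is an open immersion, and the exceptional divisor is an
effective Cartier divisor, whose complement is dense. [cite: StacksProject, Tag 02OS] [cite: GortzWedhorn2020, Prop. 13.91 (3)] -/
theorem IsPointBlowupComposition.isNowhereDense_preimage {X : Scheme.{u}} [IsNoetherian X] {T : Set X} :
    ∀ {X' : Scheme.{u}} {π : X' ⟶ X}, IsPointBlowupComposition T π → ∀ {S : Set X}, IsClosed S →
      IsNowhereDense S → T ⊆ S → IsNowhereDense (π ⁻¹' S) := by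
  intro X' π h
  induction h with
  | nil => intro S _ hS _; exact hS
  | @cons X'' X' τ σ x' hx' hσ hne hT hτ ih =>
    intro S hScl hS hTS
    have hA : IsNowhereDense (σ ⁻¹' S) := ih hScl hS hTS
    have hAcl : IsClosed (σ ⁻¹' S) := hScl.preimage σ.continuous
    have hx'A : x' ∈ σ ⁻¹' S := hTS hT
    haveI := hσ.isLocallyNoetherian
    haveI : IsProper τ := hτ.isProper
    haveI : IsLocallyNoetherian X'' := LocallyOfFiniteType.isLocallyNoetherian τ
    -- `τ⁻¹(σ⁻¹ S)` is closed; show its interior is empty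
    rw [Scheme.Hom.comp_base, TopCat.coe_comp, Set.preimage_comp]
    change interior (closure (τ ⁻¹' (σ ⁻¹' S))) = ∅
    rw [(hAcl.preimage τ.continuous).closure_eq, Set.eq_empty_iff_forall_notMem]
    intro w hw
    rw [mem_interior] at hw
    obtain ⟨W, hWA, hWopen, hwW⟩ := hw
    -- off the exceptional divisor `τ` is an open immersion
    set V : X'.Opens := centreCompl (vanishingIdeal ⟨{x'}, hx'⟩) with hV
    let F : (↑(τ ⁻¹ᵁ V) : Scheme.{u}) ⟶ X' := (τ ⁻¹ᵁ V).ι ≫ τ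
    haveI : IsOpenImmersion F := hτ.isOpenImmersion_preimage_compl_ι
    -- the part of `W` off the exceptional divisor maps onto an open subset of `σ⁻¹ S`, hence is empty
    have hWV : (W ∩ (τ ⁻¹ᵁ V : Set X'')) = ∅ := by
      rw [Set.eq_empty_iff_forall_notMem]
      rintro z ⟨hzW, hzV⟩
      have hopen : IsOpen (F '' ((τ ⁻¹ᵁ V).ι ⁻¹' W)) :=
        F.isOpenEmbedding.isOpenMap _ (hWopen.preimage (τ ⁻¹ᵁ V).ι.continuous)
      have hsub : F '' ((τ ⁻¹ᵁ V).ι ⁻¹' W) ⊆ σ ⁻¹' S := by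
        rintro _ ⟨y, hy, rfl⟩
        exact hWA hy
      have hmem : F ⟨z, hzV⟩ ∈ F '' ((τ ⁻¹ᵁ V).ι ⁻¹' W) := ⟨⟨z, hzV⟩, hzW, rfl⟩
      have hint : F ⟨z, hzV⟩ ∈ interior (closure (σ ⁻¹' S)) := by
        rw [hAcl.closure_eq]
        exact interior_mono hsub (by rw [hopen.interior_eq]; exact hmem)
      have h0 : interior (closure (σ ⁻¹' S)) = ∅ := hA
      rw [h0] at hint
      exact hint
    -- so `W` lies in the exceptional divisor, whose complement is dense
    have hWE : W ⊆ (((vanishingIdeal ⟨{x'}, hx'⟩).comap τ).support : Set X'') := by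
      intro z hzW
      by_contra hzE
      have hzV : z ∈ (τ ⁻¹ᵁ V : Set X'') := by
        change τ z ∈ (V : Set X')
        rw [hV]
        change τ z ∈ ((vanishingIdeal ⟨{x'}, hx'⟩).support : Set X')ᶜ
        intro h
        apply hzE
        rw [Scheme.IdealSheafData.support_comap]
        exact h
      exact (Set.eq_empty_iff_forall_notMem.mp hWV) z ⟨hzW, hzV⟩
    have hdense := hτ.isEffectiveCartier.dense_compl_support
    obtain ⟨z, hzW, hzc⟩ := hdense.inter_open_nonempty W hWopen ⟨w, hwW⟩
    exact hzc (hWE hzW)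

/-! ## F-75c for regular surfaces, without integrality -/

/-- **Stacks Project Lemma 54.15.6 (Tag 0BIC) with the locus of the centres, general regular surface** (`X` Noetherian
with regular local rings, excellent, `dim X ≤ 2`, not assumed integral). [cite: StacksProject, Tag 0BIC (Lemma 54.15.6)]
[cite: StacksProject, Tag 0BIB (Lemma 54.15.5)] [cite: StacksProject, Tag 0AHH (Lemma 54.4.1)] -/
theorem stacks0BIC_locus (X : Scheme.{u}) [IsNoetherian X] (Z : X.IdealSheafData)
    (hreg : Scheme.IsRegular X) (hexc : Scheme.IsExcellent X) (hdim : topologicalKrullDim X ≤ 2)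
    (hZ : IsNowhereDense (Z.support : Set X)) :
    ∃ (X' : Scheme.{u}) (π : X' ⟶ X), IsPointBlowupComposition (Z.support : Set X) π ∧
      IsEffectiveCartier (Z.comap π) ∧ IsStrictNormalCrossingsDivisor X' (π ⁻¹' (Z.support : Set X)) := by
  classical
  -- (1) Cartier step
  obtain ⟨X₁, π₁, hIPC₁, hlp⟩ := exists_isPointBlowupComposition_isLocallyPrincipal' X hreg hexc hdim Z
  obtain ⟨hN₁, hreg₁, hexc₁, hdim₁⟩ := IsPointBlowupComposition.invariants hIPC₁ hreg hexc hdim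
  haveI := hN₁
  have hnd₁ : IsNowhereDense (((Z.comap π₁).support : Set X₁)) := by
    rw [Scheme.IdealSheafData.support_comap]
    exact IsPointBlowupComposition.isNowhereDense_preimage hIPC₁ Z.support.isClosed hZ (nonPrincipalLocus_le_support Z)
  have hcart₁ : IsEffectiveCartier (Z.comap π₁) := isEffectiveCartier_of_isLocallyPrincipal_of_isNowhereDense hreg₁ hlp hnd₁
  -- (2) decomposition of `V(Z·𝒪_{X₁})` into members and isolated points
  obtain ⟨𝒞₀, P, hfin₀, hPfin, hmem₀, hPcl, hP1, hPoff, hS₁⟩ := exists_members_decomposition hreg₁ hdim₁ hcart₁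
  -- (3) bad points, then (4) triple points
  obtain ⟨Y₂, σ₂, 𝒞₂, hIPC₂, hfin₂, hmem₂, hU₂, hno₂⟩ := exists_noBadPoint X₁ hreg₁ hexc₁ hdim₁ 𝒞₀ hfin₀ hmem₀
  obtain ⟨hregC₂, htr₂⟩ := good_of_noBadPoint hno₂
  obtain ⟨Y₃, σ₃, 𝒞₃, hIPC₃, hfin₃, hmem₃, hU₃, hregC₃, htr₃, hnt₃⟩ :=
    exists_good_noTriplePoint hreg₁ hexc₁ hdim₁ σ₂ 𝒞₂ hIPC₂ hfin₂ hmem₂ hU₂ hregC₂ htr₂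
  obtain ⟨hN₃, hreg₃, hexc₃, hdim₃⟩ := IsPointBlowupComposition.invariants hIPC₃ hreg₁ hexc₁ hdim₁
  haveI := hN₃
  -- the isolated points upstairs: `σ₃` is an isomorphism near them
  set M : Set X₁ := ⋃ C ∈ 𝒞₀, (C : Set X₁) with hM
  have hMcl : IsClosed M := hfin₀.isClosed_biUnion fun C _ => C.isClosed
  set V : X₁.Opens := ⟨Mᶜ, hMcl.isOpen_compl⟩ with hV
  haveI hiso : IsIso (σ₃ ∣_ V) := hIPC₃.isIso_morphismRestrict V (Set.disjoint_compl_left_iff_subset.mpr subset_rfl)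
  have hPV : ∀ p ∈ P, p ∈ V := fun p hp hpM => by
    rw [hM, Set.mem_iUnion₂] at hpM
    obtain ⟨C, hC, hpC⟩ := hpM
    exact hPoff p hp C hC hpC
  have huniq : ∀ q : Y₃, σ₃ q ∈ P → ∀ q' : Y₃, σ₃ q' = σ₃ q → q' = q := by
    intro q hq q' hq'
    obtain ⟨q₀, -, hq₀⟩ := existsUnique_preimage_of_isIso_morphismRestrict σ₃ hiso (hPV _ hq)
    exact (hq₀ q' hq').trans (hq₀ q rfl).symm
  have hP₃fin : (σ₃ ⁻¹' P).Finite :=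
    hPfin.preimage fun q₁ h₁ q₂ h₂ h12 => huniq q₂ h₂ q₁ h12
  have hP₃cl : ∀ q ∈ σ₃ ⁻¹' P, IsClosed ({q} : Set Y₃) := by
    intro q hq
    have heq : ({q} : Set Y₃) = σ₃ ⁻¹' {σ₃ q} := by
      ext q'
      simp only [Set.mem_singleton_iff, Set.mem_preimage]
      exact ⟨fun h => by rw [h], fun h => huniq q hq q' h⟩
    rw [heq]
    exact (hPcl _ hq).preimage σ₃.continuous
  have hP₃1 : ∀ q ∈ σ₃ ⁻¹' P, ringKrullDim (Y₃.presheaf.stalk q) = 1 := by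
    intro q hq
    haveI := isIso_stalkMap_of_isIso_morphismRestrict σ₃ V q (hPV _ hq)
    rw [← hP1 _ hq]
    exact ringKrullDim_eq_of_ringEquiv (asIso (σ₃.stalkMap q)).commRingCatIsoToRingEquiv.symm
  have hP₃off : ∀ q ∈ σ₃ ⁻¹' P, ∀ C ∈ 𝒞₃, q ∉ (C : Set Y₃) := by
    intro q hq C hC hqC
    have : q ∈ σ₃ ⁻¹' M := by rw [← hU₃]; exact Set.mem_biUnion hC hqC
    exact hPV _ hq this
  have hsnc := isStrictNormalCrossingsDivisor_of_good hreg₃ hexc₃.isQuasiExcellent hdim₃ hfin₃ hmem₃ hregC₃ htr₃ hnt₃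
    hP₃fin hP₃cl hP₃1 hP₃off
  -- assemble
  refine ⟨Y₃, σ₃ ≫ π₁, ?_, ?_, ?_⟩
  · refine (hIPC₁.mono (nonPrincipalLocus_le_support Z)).comp (T₁ := M) ?_ hIPC₃
    rintro _ ⟨y, hy, rfl⟩
    have hy' : y ∈ ((Z.comap π₁).support : Set X₁) := by rw [hS₁]; exact Or.inl hy
    rwa [Scheme.IdealSheafData.support_comap] at hy'
  · rw [Scheme.IdealSheafData.comap_comp]
    exact IsPointBlowupComposition.isEffectiveCartier_comap hIPC₃ hcart₁
  · have hpre : (σ₃ ≫ π₁) ⁻¹' (Z.support : Set X) = (⋃ C ∈ 𝒞₃, (C : Set Y₃)) ∪ σ₃ ⁻¹' P := by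
      rw [Scheme.Hom.comp_base, TopCat.coe_comp, Set.preimage_comp, hU₃]
      have : π₁ ⁻¹' (Z.support : Set X) = ((Z.comap π₁).support : Set X₁) := by
        rw [Scheme.IdealSheafData.support_comap]; rfl
      rw [this, hS₁, Set.preimage_union]
    rw [hpre]
    exact hsnc

end F75c

/-! ## The discharge -/

open Literature.AlgebraicGeometry.Resolution in
/-- **F-75c HOLDS — The Stacks Project, Lemma 54.15.6 (Tag 0BIC) with the locus of the centres read from its proof**
(Tags 0BIB/0AHH for the Cartier step, 0BI7 for the intersection multiplicities, 0BIA for the end state): for a Noetherian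
scheme `X` with regular local rings, excellent, of dimension `2`, and an ideal sheaf `Z` with nowhere dense support, there is a
composition of blowing ups at closed points lying over `V(Z)` after which `Z·𝒪` is an effective Cartier divisor whose
support is a strict normal crossings divisor. Users' hypotheses `(h75c : Stacks0BIC_embeddedResolutionCurvesInSurfaces_locus)`
are fed this theorem. [cite: StacksProject, Tag 0BIC (Lemma 54.15.6)] [cite: StacksProject, Tag 0BIB (Lemma 54.15.5, proof)]
[cite: StacksProject, Tag 0AHH (Lemma 54.4.1)] -/
theorem stacks0BIC_embeddedResolutionCurvesInSurfaces_locus_holds :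
    Stacks0BIC_embeddedResolutionCurvesInSurfaces_locus.{u} := by
  intro X _ Z hreg hexc hdim hZ
  exact F75c.stacks0BIC_locus X Z hreg hexc hdim.le hZ

end Summit.ResolutionOfSingularities.ResolutionOfSingularities.Theorems

end
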